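import Summits.HodgeConjecture.CorCM.MumfordTateRankQuaternionLefschetzBound
import HarnessLib

/-!
# The Lefschetz Lie algebra over a totally real centre: `dim_ℚ (C(End⁰B) ∩ 𝔰𝔭(ψ)) = e · dim_K (C_K(i, j) ∩ 𝔰𝔭(ψ_K))`

Sub-problem `CorCM` of `HodgeConjecture` (cell `pub-hodgecm2`, count-neutral Mumford–Tate-rank lane of seat `b27`; theorems only,
no new definition, no named fact; nothing here uses or asserts `HC_CM`).  Companion of `CorCM/MumfordTateRankQuaternionLefschetzBound`
(which bounds `dim Lie Hg(H¹B)`): here the LEFSCHETZ Lie algebra itself, `Lef(ψ) = C(End_Hdg(H¹B)) ∩ 𝔰𝔭(H¹B, ψ)` (the Lie algebra of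
Milne's `S(B)`, resp. of Murty's Lefschetz group), is computed EXACTLY when `End⁰B` is a quaternion algebra over a totally real field
`K` of degree `e` given with a quaternionic basis `End⁰B ≃ₐ[K] (a, b / K)` whose first vector `i` is Rosati-skew:
`dim_ℚ Lef(ψ) = e · M` with `8M + 2n = n²` if `j` is Rosati-skew (type III) and `8M = n² + 2n` if `j` is Rosati-symmetric (type II),
`n = dim_K H¹B` — i.e. `Lef(ψ) = Res_{K/ℚ}` of the `K`-Lie algebra `C_K(i, j) ∩ 𝔰𝔭(ψ_K)`, `ψ = Tr_{K/ℚ} ∘ ψ_K`.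

METHOD.  As in the companion file, `H¹B` is a `K`-space through `bettiRep`, the Rosati involution fixes the centre (no type IV), `ψ`
is `K`-balanced and descends along the trace (`LinearAlgebra/QuadraticForm/TraceFormDescent`), and restriction of scalars identifies
`{T ∈ End_K(H¹B) : T i = i T, T j = j T, T ∈ 𝔰𝔭(ψ_K)}` with `Lef(ψ)`: `⊆` because `End_Hdg(H¹B) = ρ(End⁰B)` (Riemann,
`exists_unop_bettiRep_eq_of_mem_endAlg`) and `End⁰B = K ⊕ K i ⊕ K j ⊕ K ij` (Mathlib's `QuaternionAlgebra.lift`); `⊇` because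
elements of `Lef(ψ)` commute with `ρ(K) ⊆ End_Hdg`.  The `K`-dimension is `Algebra/Lie/QuaternionCentralizerSkewDimensionForm`.

* `exists_finrank_lefschetz_eq_of_centre_basis` — the engine (both signs).

## References
* [Milne1999LefschetzClasses] J. S. Milne, *Lefschetz classes on abelian varieties*, Duke Math. J. 96 (1999), §2 and Summary
  (`C(A) ⊗ ℝ`, `S(A) ⊗ ℝ` for types II(e), III(e): `Sp_{g/e}` resp. `O_{g/e}` over each real place of `F`, `dim = g²/2f ± g/2`).
* [Murty1984ExceptionalHodgeClasses] V. K. Murty, Math. Ann. 268 (1984), §2 (the Lefschetz group as the centraliser of `End⁰` in `Sp`).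
* [MoonenZarhin1999LowDim] B. Moonen, Yu. G. Zarhin, Duke Math. J. 77 (1995) / Math. Ann. 315 (1999), §1 (notation `hg ⊆ 𝔰𝔭`).
-/

noncomputable section

namespace Summit.HodgeConjecture.CorCM

open scoped TensorProduct Quaternion
open CategoryTheory CategoryTheory.Limits Module NumberField
open Literature.AlgebraicGeometry.Motives
open Literature.AlgebraicGeometry.Motives.AbelianVariety
open Literature.AlgebraicGeometry.Motives.HodgeStructure
open Literature.AlgebraicGeometry.HodgeTheory
open Literature.AlgebraicGeometry.ComplexMultiplication (bettiRep bettiRep_injective)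
open Literature.NumberTheory.Automorphic (IsQuaternionAlgebra)
open Literature.RingTheory.CentralSimple
open Literature.Algebra.Lie
open Literature.LinearAlgebra.QuadraticForm

variable [HodgeTensorFacts.{0, 0}]

/-! ## The engine: `Lef(ψ) ≅ Res_{K/ℚ} (C_K(i, j) ∩ 𝔰𝔭(ψ_K))` -/

/-- **The Lefschetz Lie algebra over a totally real centre.**  Let `End⁰B` be a quaternion algebra over a totally real number
field `K` with a quaternionic `K`-basis `1, i, j, ij` (`i² = a`, `j² = b`, `ij = -ji`, `a, b ∈ K×`; `q.liftHom : (a, b / K) ≃ End⁰B`),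
`ψ` a polarization of `H¹B` with `i^ros = -i`.  Then `dim_ℚ (C(End_Hdg(H¹B)) ∩ 𝔰𝔭(ψ)) = e · M` and `e · n = dim_ℚ H¹B`, where
`8M + 2n = n²` if `j^ros = -j` and `8M = n² + 2n` if `j^ros = j` (`M = dim_K (C_K(i, j) ∩ 𝔰𝔭(ψ_K))`, `ψ = Tr_{K/ℚ} ∘ ψ_K`).
[cite: Milne1999LefschetzClasses, §2 and Summary] [cite: Murty1984ExceptionalHodgeClasses, §2] -/
theorem exists_finrank_lefschetz_eq_of_centre_basis {B : AbelianVariety ℂ} {K : Type} [Field K] [NumberField K] [IsTotallyReal K]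
    [Algebra K B.endAlgebra] [IsScalarTower ℚ K B.endAlgebra] [IsQuaternionAlgebra K B.endAlgebra]
    [Module.Finite ℚ (bettiCohomology B.X 1)]
    (ψ : (BettiUniverse.hodge exists_isReal_hodgeModel_holds (AbelianVariety.isSmoothProjective_holds (A := B)) 1).Polarization)
    {a b : K} (ha : a ≠ 0) (hb : b ≠ 0) (q : QuaternionAlgebra.Basis B.endAlgebra a 0 b)
    (hq : Function.Bijective q.liftHom)
    (hru : AbelianVariety.rosati B exists_isReal_hodgeModel_holds hodgePQ_independent_of_hodgeModel_holds ψ q.i = -q.i) :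
    ∃ n M : ℕ, Module.finrank ℚ K * n = Module.finrank ℚ (bettiCohomology B.X 1) ∧
      Module.finrank ℚ ↥(Subalgebra.toSubmodule (Subalgebra.centralizer ℚ
          ((BettiUniverse.hodge exists_isReal_hodgeModel_holds (AbelianVariety.isSmoothProjective_holds (A := B)) 1).endAlg :
            Set (Module.End ℚ (bettiCohomology B.X 1)))) ⊓ ψ.form.skewAdjointSubmodule) = Module.finrank ℚ K * M ∧
      (AbelianVariety.rosati B exists_isReal_hodgeModel_holds hodgePQ_independent_of_hodgeModel_holds ψ q.j = -q.j →
        8 * M + 2 * n = n * n) ∧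
      (AbelianVariety.rosati B exists_isReal_hodgeModel_holds hodgePQ_independent_of_hodgeModel_holds ψ q.j = q.j →
        8 * M = n * n + 2 * n) := by
  classical
  -- the quaternionic basis `1, i, j, ij` of `End⁰B` over `K`
  have hu : q.i * q.i = algebraMap K B.endAlgebra a := by rw [q.i_mul_i, zero_smul, add_zero, Algebra.algebraMap_eq_smul_one]
  have hv : q.j * q.j = algebraMap K B.endAlgebra b := by rw [q.j_mul_j, Algebra.algebraMap_eq_smul_one]
  have huv : q.i * q.j = -(q.j * q.i) := by rw [q.j_mul_i, q.i_mul_j, zero_smul, zero_sub, neg_neg]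
  have hdec : ∀ z : B.endAlgebra, ∃ c₀ c₁ c₂ c₃ : K, z = algebraMap K _ c₀ + c₁ • q.i + c₂ • q.j + c₃ • (q.i * q.j) := fun z => by
    obtain ⟨x, rfl⟩ := hq.2 z
    exact ⟨x.re, x.imI, x.imJ, x.imK, by rw [QuaternionAlgebra.Basis.liftHom_apply, QuaternionAlgebra.Basis.lift, q.i_mul_j]⟩
  have hHD : exists_isReal_hodgeModel := exists_isReal_hodgeModel_holds
  have hI : hodgePQ_independent_of_hodgeModel := hodgePQ_independent_of_hodgeModel_holds
  have hX : IsSmoothProjective B.dim B.X := AbelianVariety.isSmoothProjective_holds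
  have hA4 : HasNoTypeIVFactor B := AbelianVariety.hasNoTypeIVFactor_of_isTotallyReal (K := K)
  -- `ρ = unop ∘ bettiRep`, Riemann's anti-isomorphism onto `End_Hdg(H¹B)`
  let ρ : B.endAlgebra → Module.End ℚ (bettiCohomology B.X 1) := fun z => MulOpposite.unop (bettiRep B z)
  have hρ : ∀ z, ρ z = MulOpposite.unop (bettiRep B z) := fun z => rfl
  have hρmul : ∀ z w, ρ (z * w) = ρ w * ρ z := fun z w => by rw [hρ, hρ, hρ, map_mul, MulOpposite.unop_mul]
  have hρadd : ∀ z w, ρ (z + w) = ρ z + ρ w := fun z w => by rw [hρ, hρ, hρ, map_add, MulOpposite.unop_add]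
  have hρneg : ∀ z, ρ (-z) = -ρ z := fun z => by rw [hρ, hρ, map_neg, MulOpposite.unop_neg]
  have hρzero : ρ 0 = 0 := by rw [hρ, map_zero, MulOpposite.unop_zero]
  have hρone : ρ 1 = 1 := by rw [hρ, map_one, MulOpposite.unop_one]
  have hρrat : ∀ r : ℚ, ρ (algebraMap ℚ B.endAlgebra r) = r • (1 : Module.End ℚ (bettiCohomology B.X 1)) := fun r => by
    rw [hρ, AlgHom.commutes, MulOpposite.algebraMap_apply, MulOpposite.unop_op, Algebra.algebraMap_eq_smul_one]
  have hρA : ∀ z, ρ z ∈ (BettiUniverse.hodge exists_isReal_hodgeModel_holds (AbelianVariety.isSmoothProjective_holds (A := B)) 1).endAlg := fun z =>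
    Literature.AlgebraicGeometry.ComplexMultiplication.unop_bettiRep_mem_endAlg hHD hI z
  have hτρ : ∀ z, ψ.adjoint (ρ z) =
      ρ (AbelianVariety.rosati B exists_isReal_hodgeModel_holds hodgePQ_independent_of_hodgeModel_holds ψ z) :=
    fun z => (AbelianVariety.unop_bettiRep_rosati hHD hI ψ z).symm
  obtain ⟨Lef, hLef⟩ : ∃ Lef : Submodule ℚ (Module.End ℚ (bettiCohomology B.X 1)), Lef =
      Subalgebra.toSubmodule (Subalgebra.centralizer ℚ
        ((BettiUniverse.hodge exists_isReal_hodgeModel_holds (AbelianVariety.isSmoothProjective_holds (A := B)) 1).endAlg :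
          Set (Module.End ℚ (bettiCohomology B.X 1)))) ⊓ ψ.form.skewAdjointSubmodule := ⟨_, rfl⟩
  have hmemLef : ∀ {Y : Module.End ℚ (bettiCohomology B.X 1)}, Y ∈ Lef ↔
      (∀ g ∈ (BettiUniverse.hodge exists_isReal_hodgeModel_holds (AbelianVariety.isSmoothProjective_holds (A := B)) 1).endAlg,
        g * Y = Y * g) ∧ ∀ x y, ψ.form (Y x) y = -ψ.form x (Y y) := fun {Y} => by
    rw [hLef, Submodule.mem_inf, Subalgebra.mem_toSubmodule, Subalgebra.mem_centralizer_iff, LinearMap.mem_skewAdjointSubmodule]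
    refine and_congr_right fun _ => forall_congr' fun x => forall_congr' fun y => ?_
    rw [Pi.neg_apply, map_neg]
  rw [← hLef]
  -- the centre `K` acts by Rosati-fixed endomorphisms commuting with `ρ(End⁰B)`
  have hcenK : ∀ (c : K) (z : B.endAlgebra), ρ (algebraMap K _ c) * ρ z = ρ z * ρ (algebraMap K _ c) := fun c z => by
    rw [← hρmul, ← hρmul, Algebra.commutes]
  have hrosK : ∀ c : K, AbelianVariety.rosati B exists_isReal_hodgeModel_holds hodgePQ_independent_of_hodgeModel_holds ψ (algebraMap K _ c) = algebraMap K _ c := fun c =>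
    AbelianVariety.rosati_eq_self_of_mem_center hHD hI ψ hA4 (Subalgebra.mem_center_iff.2 fun z => (Algebra.commutes c z).symm)
  -- `H¹B` as a `K`-vector space
  let f : K →+* Module.End ℚ (bettiCohomology B.X 1) :=
    { toFun := fun c => ρ (algebraMap K _ c)
      map_one' := by rw [map_one, hρone]
      map_mul' := fun c c' => by rw [mul_comm c c', map_mul, hρmul]
      map_zero' := by rw [map_zero, hρzero]
      map_add' := fun c c' => by rw [map_add, hρadd] }
  letI : Module K (bettiCohomology B.X 1) := Module.compHom _ f
  have hsmulK : ∀ (c : K) (x : bettiCohomology B.X 1), c • x = ρ (algebraMap K _ c) x := fun c x => rfl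
  haveI : IsScalarTower ℚ K (bettiCohomology B.X 1) := ⟨fun q c x => by
    rw [hsmulK, hsmulK, Algebra.smul_def, map_mul, ← IsScalarTower.algebraMap_apply ℚ K B.endAlgebra q, hρmul, hρrat,
      Module.End.mul_apply, LinearMap.smul_apply, Module.End.one_apply, map_smul]⟩
  haveI : Module.Finite K (bettiCohomology B.X 1) := Module.Finite.of_restrictScalars_finite ℚ K _
  -- `ψ` is `K`-balanced (Rosati fixes the centre) and descends along the trace
  have hbal : ∀ (c : K) (x y : bettiCohomology B.X 1), ψ.form (c • x) y = ψ.form x (c • y) := fun c x y => by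
    rw [hsmulK, hsmulK, ← ψ.form_apply_adjoint (ρ (algebraMap K _ c)) x y, hτρ, hrosK]
  obtain ⟨ψK, hψK⟩ := TraceFormDescent.exists_forall_trace_mul_eq (k := ℚ) ψ.form hbal
  have hψanti : ∀ x y : bettiCohomology B.X 1, ψ.form y x = -ψ.form x y := fun x y => by
    have h := LinearMap.congr_fun₂ ψ.flip_form x y
    rw [show (((1 : ℕ) : ℤ).negOnePow : ℤˣ) = -1 from Int.negOnePow_one, Units.val_neg, Units.val_one, neg_one_zsmul] at h
    simpa only [LinearMap.BilinForm.flip_apply, LinearMap.neg_apply] using h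
  have hψKanti : ∀ x y, ψK y x = -ψK x y := (TraceFormDescent.flip_eq_neg_iff_of_trace hψK hbal).1 hψanti
  have hψKflip : ψK.flip = -ψK := LinearMap.ext fun x => LinearMap.ext fun y => by
    rw [LinearMap.BilinForm.flip_apply, LinearMap.neg_apply, LinearMap.neg_apply, hψKanti]
  have hψKL : ∀ x, (∀ y, ψK x y = 0) → x = 0 := TraceFormDescent.separatingLeft_of_trace hψK ψ.nondegenerate.1
  have hψKnd : ψK.Nondegenerate := ⟨hψKL, fun y hy => hψKL y fun x => by rw [hψKanti, hy x, neg_zero]⟩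
  -- elements of `End⁰B` act `K`-linearly: `ρK z`
  have hρK : ∀ z : B.endAlgebra, ∃ T : bettiCohomology B.X 1 →ₗ[K] bettiCohomology B.X 1, ∀ x, T x = ρ z x := fun z =>
    ⟨{ toFun := ρ z, map_add' := map_add (ρ z), map_smul' := fun c x => by
        rw [RingHom.id_apply, hsmulK, hsmulK, ← Module.End.mul_apply, ← hcenK, Module.End.mul_apply] }, fun x => rfl⟩
  obtain ⟨iK, hiK⟩ := hρK q.i
  obtain ⟨jK, hjK⟩ := hρK q.j
  have hiK2 : iK * iK = algebraMap K _ a := LinearMap.ext fun x => by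
    rw [Module.End.mul_apply, hiK, hiK, ← Module.End.mul_apply, ← hρmul, hu, Module.algebraMap_end_apply, hsmulK]
  have hjK2 : jK * jK = algebraMap K _ b := LinearMap.ext fun x => by
    rw [Module.End.mul_apply, hjK, hjK, ← Module.End.mul_apply, ← hρmul, hv, Module.algebraMap_end_apply, hsmulK]
  have hijK : iK * jK = -(jK * iK) := LinearMap.ext fun x => by
    rw [Module.End.mul_apply, LinearMap.neg_apply, Module.End.mul_apply, hiK, hjK, hjK, hiK, ← Module.End.mul_apply,
      ← Module.End.mul_apply (ρ q.j), ← hρmul, ← hρmul, huv, hρneg, LinearMap.neg_apply, neg_neg]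
  -- adjoints over `K`: `ψ_K(ρ(z) x, y) = ψ_K(x, ρ(z^ros) y)` (transfer along the trace)
  have hpair : ∀ (z : B.endAlgebra) (T : bettiCohomology B.X 1 →ₗ[K] bettiCohomology B.X 1), (∀ x, T x = ρ z x) →
      ∀ x y, ψK (T x) y = ψK x ((ρ (AbelianVariety.rosati B exists_isReal_hodgeModel_holds hodgePQ_independent_of_hodgeModel_holds ψ z)) y) := by
    intro z T hT
    obtain ⟨S, hS⟩ := hρK (AbelianVariety.rosati B exists_isReal_hodgeModel_holds hodgePQ_independent_of_hodgeModel_holds ψ z)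
    have h := (TraceFormDescent.isAdjointPair_iff_of_trace hψK T S).1 fun x y => by
      have e1 := ψ.form_apply_adjoint (ρ z) x y
      rw [hτρ] at e1
      rw [hT, hS]
      exact e1.symm
    intro x y
    rw [h, hS]
  have hiKskew : ψK.IsSkewAdjoint iK := fun x y => by
    rw [Pi.neg_apply, hpair q.i iK hiK x y, hru, hρneg, LinearMap.neg_apply, hiK, map_neg]
  -- every element of `Lef(ψ)` is `K`-linear, commutes with `i, j` and is `ψ_K`-skew
  obtain ⟨MK, hMK⟩ : ∃ MK : Submodule K (bettiCohomology B.X 1 →ₗ[K] bettiCohomology B.X 1), MK =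
      Subalgebra.toSubmodule (Subalgebra.centralizer K ({iK, jK} : Set (bettiCohomology B.X 1 →ₗ[K] bettiCohomology B.X 1))) ⊓
        ψK.skewAdjointSubmodule := ⟨_, rfl⟩
  have hlift : ∀ Y ∈ Lef, ∃ T : bettiCohomology B.X 1 →ₗ[K] bettiCohomology B.X 1, (∀ x, T x = Y x) ∧ T ∈ MK := by
    intro Y hY
    have hcommY : ∀ z, Y * ρ z = ρ z * Y := fun z => ((hmemLef.1 hY).1 (ρ z) (hρA z)).symm
    obtain ⟨T, hT⟩ : ∃ T : bettiCohomology B.X 1 →ₗ[K] bettiCohomology B.X 1, ∀ x, T x = Y x :=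
      ⟨{ toFun := Y, map_add' := map_add Y, map_smul' := fun c x => by
          rw [RingHom.id_apply, hsmulK, hsmulK, ← Module.End.mul_apply, hcommY, Module.End.mul_apply] }, fun x => rfl⟩
    refine ⟨T, hT, ?_⟩
    rw [hMK]
    refine Submodule.mem_inf.2 ⟨?_, ?_⟩
    · rw [Subalgebra.mem_toSubmodule, Subalgebra.mem_centralizer_iff]
      intro g hg
      simp only [Set.mem_insert_iff, Set.mem_singleton_iff] at hg
      rcases hg with rfl | rfl
      · refine LinearMap.ext fun x => ?_
        rw [Module.End.mul_apply, Module.End.mul_apply, hT, hiK, hiK, hT, ← Module.End.mul_apply, ← hcommY q.i,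
          Module.End.mul_apply]
      · refine LinearMap.ext fun x => ?_
        rw [Module.End.mul_apply, Module.End.mul_apply, hT, hjK, hjK, hT, ← Module.End.mul_apply, ← hcommY q.j,
          Module.End.mul_apply]
    · rw [LinearMap.mem_skewAdjointSubmodule]
      have h := (TraceFormDescent.isAdjointPair_iff_of_trace hψK T (-T)).1 fun x y => by
        rw [hT, LinearMap.neg_apply, hT, map_neg]
        exact (hmemLef.1 hY).2 x y
      intro x y
      rw [Pi.neg_apply, h x y, LinearMap.neg_apply]
  -- conversely, every element of `M_K` restricts to an element of `Lef(ψ)` (`End_Hdg = ρ(End⁰B)`, `End⁰B = K⟨1, i, j, ij⟩`)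
  have hdesc : ∀ T ∈ MK, (T.restrictScalars ℚ : Module.End ℚ (bettiCohomology B.X 1)) ∈ Lef := by
    intro T hTM
    rw [hMK, Submodule.mem_inf, Subalgebra.mem_toSubmodule, Subalgebra.mem_centralizer_iff, LinearMap.mem_skewAdjointSubmodule] at hTM
    obtain ⟨hTc, hTs⟩ := hTM
    have hTi : ∀ x, T (iK x) = iK (T x) := fun x => by
      rw [← Module.End.mul_apply, ← hTc iK (by simp), Module.End.mul_apply]
    have hTj : ∀ x, T (jK x) = jK (T x) := fun x => by
      rw [← Module.End.mul_apply, ← hTc jK (by simp), Module.End.mul_apply]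
    -- `T` commutes with `ρ(z)` for every `z ∈ End⁰B`
    have hPK : ∀ c : K, ∀ x, T (ρ (algebraMap K _ c) x) = ρ (algebraMap K _ c) (T x) := fun c x => by
      rw [← hsmulK, ← hsmulK, map_smul]
    have hPmul : ∀ z w : B.endAlgebra, (∀ x, T (ρ z x) = ρ z (T x)) → (∀ x, T (ρ w x) = ρ w (T x)) →
        ∀ x, T (ρ (z * w) x) = ρ (z * w) (T x) := fun z w hz hw x => by
      rw [hρmul, Module.End.mul_apply, Module.End.mul_apply, hw, hz]
    have hPadd : ∀ z w : B.endAlgebra, (∀ x, T (ρ z x) = ρ z (T x)) → (∀ x, T (ρ w x) = ρ w (T x)) →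
        ∀ x, T (ρ (z + w) x) = ρ (z + w) (T x) := fun z w hz hw x => by
      rw [hρadd, LinearMap.add_apply, LinearMap.add_apply, map_add, hz, hw]
    have hPsmul : ∀ (c : K) (z : B.endAlgebra), (∀ x, T (ρ z x) = ρ z (T x)) →
        ∀ x, T (ρ (c • z) x) = ρ (c • z) (T x) := fun c z hz => by
      rw [Algebra.smul_def]; exact hPmul _ _ (hPK c) hz
    have hPi : ∀ x, T (ρ q.i x) = ρ q.i (T x) := fun x => by rw [← hiK, ← hiK, hTi]
    have hPj : ∀ x, T (ρ q.j x) = ρ q.j (T x) := fun x => by rw [← hjK, ← hjK, hTj]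
    have hP : ∀ z : B.endAlgebra, ∀ x, T (ρ z x) = ρ z (T x) := fun z => by
      obtain ⟨c₀, c₁, c₂, c₃, rfl⟩ := hdec z
      exact hPadd _ _ (hPadd _ _ (hPadd _ _ (hPK c₀) (hPsmul c₁ _ hPi)) (hPsmul c₂ _ hPj)) (hPsmul c₃ _ (hPmul _ _ hPi hPj))
    refine hmemLef.2 ⟨fun g hg => ?_, fun x y => ?_⟩
    · obtain ⟨z, hz⟩ := exists_unop_bettiRep_eq_of_mem_endAlg (AbelianVariety.isSmoothProjective_holds (A := B)) hg
      refine LinearMap.ext fun x => ?_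
      rw [Module.End.mul_apply, Module.End.mul_apply, LinearMap.restrictScalars_apply, LinearMap.restrictScalars_apply, ← hz,
        ← hρ, hP]
    · have h := (TraceFormDescent.isAdjointPair_iff_of_trace hψK T (-T)).2 fun x y => by
        rw [LinearMap.neg_apply, ← Pi.neg_apply (T : bettiCohomology B.X 1 → bettiCohomology B.X 1) y]; exact hTs x y
      rw [LinearMap.restrictScalars_apply, LinearMap.restrictScalars_apply, h, LinearMap.neg_apply, map_neg]
  -- the two `ℚ`-linear injections `Lef(ψ) ↪ M_K ↪ Lef(ψ)`
  choose T hT hTmem using hlift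
  let Φ : Lef →ₗ[ℚ] MK :=
    { toFun := fun Y => ⟨T Y Y.2, hTmem Y Y.2⟩
      map_add' := fun Y Y' => Subtype.ext (LinearMap.ext fun x => by
        change T _ (Y + Y').2 x = T Y Y.2 x + T Y' Y'.2 x
        rw [hT, hT, hT]
        rfl)
      map_smul' := fun r Y => Subtype.ext (LinearMap.ext fun x => by
        change T _ (r • Y).2 x = r • T Y Y.2 x
        rw [hT, hT]
        rfl) }
  have hΦ : Function.Injective Φ := by
    intro Y Y' h
    apply Subtype.ext
    refine LinearMap.ext fun x => ?_
    have h' : T Y Y.2 = T Y' Y'.2 := congrArg Subtype.val h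
    rw [← hT Y Y.2, ← hT Y' Y'.2, h']
  let Ψ : MK →ₗ[ℚ] Lef :=
    { toFun := fun S => ⟨(S : bettiCohomology B.X 1 →ₗ[K] bettiCohomology B.X 1).restrictScalars ℚ, hdesc S S.2⟩
      map_add' := fun S S' => rfl
      map_smul' := fun r S => rfl }
  have hΨ : Function.Injective Ψ := by
    intro S S' h
    apply Subtype.ext
    refine LinearMap.ext fun x => ?_
    exact LinearMap.congr_fun (congrArg Subtype.val h) x
  haveI : Module.Finite K MK := inferInstance
  haveI : Module.Finite ℚ MK := Module.Finite.trans K MK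
  have hle := LinearMap.finrank_le_finrank_of_injective hΦ
  have hge := LinearMap.finrank_le_finrank_of_injective hΨ
  have hMKq : Module.finrank ℚ MK = Module.finrank ℚ K * Module.finrank K MK := (Module.finrank_mul_finrank ℚ K MK).symm
  have hn : Module.finrank ℚ K * Module.finrank K (bettiCohomology B.X 1) = Module.finrank ℚ (bettiCohomology B.X 1) :=
    Module.finrank_mul_finrank ℚ K (bettiCohomology B.X 1)
  refine ⟨Module.finrank K (bettiCohomology B.X 1), Module.finrank K MK, hn, by rw [← hMKq]; exact le_antisymm hle hge,
    fun hrv => ?_, fun hrv => ?_⟩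
  · -- type III: `j` is `ψ_K`-skew
    have hjKskew : ψK.IsSkewAdjoint jK := fun x y => by
      rw [Pi.neg_apply, hpair q.j jK hjK x y, hrv, hρneg, LinearMap.neg_apply, hjK, map_neg]
    have hcount := QuaternionCentralizerForm.eight_mul_finrank_centralizer_inf_skewAdjoint_add ψK hψKnd hψKflip ha hb hiK2
      hjK2 hijK hiKskew hjKskew
    rw [← hMK] at hcount
    exact hcount
  · -- type II: `j` is `ψ_K`-symmetric
    have hjKsymm : LinearMap.IsAdjointPair ψK ψK jK jK := fun x y => by
      rw [hpair q.j jK hjK x y, hrv, hjK]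
    have hcount := QuaternionCentralizerForm.eight_mul_finrank_centralizer_inf_skewAdjoint_orth ψK hψKnd hψKflip ha hb hiK2
      hjK2 hijK hiKskew hjKsymm
    rw [← hMK] at hcount
    exact hcount

end Summit.HodgeConjecture.CorCM

end
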